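import Summits.HodgeConjecture.HodgeConjecture.Theorems.EightfoldBlochSeedsChernCharacterOnBettiAnalytificationIso
import Literature.AlgebraicGeometry.HodgeTheory.SectionFramesOfTrivialisations
import HarnessLib

/-!
# K1 (analytification bridge): a morphism of modules `φ : F₁ → F₂` analytifies to a bundle map
# `u : F₁(ℂ) → F₂(ℂ)` (GAGA functoriality `u ↦ u^an`; first step of K1f, short exact sequences)

Route `EightfoldBlochSeeds` / item `stmt-HodgeConjecture-19780` (`ChernCharacterOnBetti`), helper
(`--supports`). HONEST FRAMING: nothing here proves 19780 / 18880 / 18882 / 18883 / H2 / HC_AV / HC;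
no definition, no named fact.

WHAT. Serre, GAGA §3 n°9–10: `F ↦ F^h` is a functor and the comparison maps are natural. For data
`(E₁, α₁)` of `F₁` (frames of size `r` near every point) and `(E₂, α₂)` of `F₂` and a morphism
`φ : F₁ ⟶ F₂` of `𝒪_X`-modules:

* `continuous_totalSpaceMk_sum_smul` — a linear combination `z ↦ Σᵢ cᵢ(z) τᵢ(f z)` of continuous
  sections of a complex vector bundle with continuous coefficients is continuous into the total space
  (Milnor–Stasheff §2, local triviality; the computation of `FramedBundleTrivial` made reusable);
* `comparison_comp_hom` — `α₂ ∘ φ` is again additive, `𝒪_X`-linear, restriction-compatible and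
  continuous on `U(ℂ)`;
* **`exists_bundleMap_of_comparison_hom`** — there are `ℂ`-linear fibre maps `u_P : (E₁)_P → (E₂)_P`
  with `u(α₁(σ)(P)) = α₂(φ σ)(P)` for all sections, whose total map `E₁ → E₂` is CONTINUOUS (a bundle
  morphism over `X(ℂ)`): `u^an`. Uniqueness of such `u` on fibres is `comparison_eq_of_frame` (step 4).

[cite: SerreGAGA1956, §3 n°9 Déf. 2 and Prop. 10] [cite: MilnorStasheff1974, §2 Thm. 2.2 and Lemma 2.3]
-/

noncomputable section

-- single-problem summit (Problem = Summit): the mandated namespace repeats `HodgeConjecture`.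
set_option linter.dupNamespace false

open CategoryTheory AlgebraicGeometry Bundle Topology Filter
open Literature.AlgebraicGeometry.Motives Literature.AlgebraicGeometry.HodgeTheory
open Literature.AlgebraicTopology.SingularHomology Literature.AlgebraicTopology.CharacteristicClasses

namespace Summit.HodgeConjecture.HodgeConjecture.Theorems

/-- **Linear combinations of continuous sections with continuous coefficients are continuous into the
total space**: for a complex vector bundle `E` on `B`, continuous global sections `τᵢ`, a continuous
`f : Z → B` and continuous `cᵢ : Z → ℂ`, the map `z ↦ Σᵢ cᵢ(z) τᵢ(f z) ∈ E_{f z}` is continuous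
`Z → E` (read in the local trivialisation at `f z₀`, where it is a sum of products of continuous
functions). [cite: MilnorStasheff1974, §2 Thm. 2.2 and Lemma 2.3] -/
theorem continuous_totalSpaceMk_sum_smul {B Z : Type} [TopologicalSpace B] [TopologicalSpace Z] {ι : Type} [Fintype ι]
    (E : ComplexVectorBundle.{0, 0} B) (τ : ι → (b : B) → E.E b)
    (hτ : ∀ i, Continuous fun b ↦ (⟨b, τ i b⟩ : TotalSpace E.F E.E)) {f : Z → B} (hf : Continuous f)
    (c : ι → Z → ℂ) (hc : ∀ i, Continuous (c i)) :
    Continuous fun z ↦ (⟨f z, ∑ i, c i z • τ i (f z)⟩ : TotalSpace E.F E.E) := by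
  classical
  have hread : ∀ (x₀ : B) (i : ι),
      ContinuousAt (fun x : B ↦ (trivializationAt E.F E.E x₀ ⟨x, τ i x⟩).2) x₀ := by
    intro x₀ i
    have h1 : ContinuousAt (trivializationAt E.F E.E x₀) ⟨x₀, τ i x₀⟩ :=
      (trivializationAt E.F E.E x₀).continuousAt
        ((trivializationAt E.F E.E x₀).mem_source.2 (mem_baseSet_trivializationAt E.F E.E x₀))
    have h2 : ContinuousAt (fun x : B ↦ trivializationAt E.F E.E x₀ ⟨x, τ i x⟩) x₀ :=
      ContinuousAt.comp (f := fun x : B ↦ (⟨x, τ i x⟩ : TotalSpace E.F E.E)) h1 (hτ i).continuousAt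
    exact h2.snd
  refine continuous_iff_continuousAt.2 fun z₀ ↦ ?_
  rw [FiberBundle.continuousAt_totalSpace]
  refine ⟨hf.continuousAt, ?_⟩
  have hsum : ContinuousAt (fun z : Z ↦
      ∑ i, c i z • (trivializationAt E.F E.E (f z₀) ⟨f z, τ i (f z)⟩).2) z₀ :=
    tendsto_finsetSum _ fun i _ ↦
      ((hc i).continuousAt).smul ((hread (f z₀) i).comp hf.continuousAt)
  refine hsum.congr ?_
  have hopen : IsOpen (f ⁻¹' (trivializationAt E.F E.E (f z₀)).baseSet) :=
    (trivializationAt E.F E.E (f z₀)).open_baseSet.preimage hf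
  filter_upwards [hopen.mem_nhds (mem_baseSet_trivializationAt E.F E.E (f z₀))] with z hz
  exact (ComplexVectorBundle.trivialization_snd_sum_smul E _ hz τ (fun i ↦ c i z)).symm

variable {X : SchemeOver ℂ} {F₁ F₂ : X.left.Modules} {r : ℕ}

/-- **Composing a comparison map with a morphism of modules**: for a datum `(E₂, α₂)` of `F₂` and
`φ : F₁ ⟶ F₂`, the maps `σ ↦ α₂(φ σ)` on the sections of `F₁` are additive, `𝒪_X`-linear,
restriction-compatible and continuous on `U(ℂ)`. [cite: SerreGAGA1956, §3 n°9 Déf. 2] -/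
theorem comparison_comp_hom (φ : F₁ ⟶ F₂) (E₂ : ComplexVectorBundle.{0, 0} (ComplexPoints X))
    (α₂ : ∀ U : X.left.Opens, Γ(F₂, U) → ∀ P : ComplexPoints X, E₂.E P)
    (hadd : ∀ (U : X.left.Opens) (σ τ : Γ(F₂, U)) (P : ComplexPoints X), α₂ U (σ + τ) P = α₂ U σ P + α₂ U τ P)
    (hsmul : ∀ (U : X.left.Opens) (f : Γ(X.left, U)) (σ : Γ(F₂, U)) (P : ComplexPoints X) (h : P.pt ∈ U),
      α₂ U (f • σ) P = P.eval U h f • α₂ U σ P)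
    (hres : ∀ (U W : X.left.Opens) (hWU : W ≤ U) (σ : Γ(F₂, U)) (P : ComplexPoints X), P.pt ∈ W →
      α₂ W (F₂.presheaf.map (homOfLE hWU).op σ) P = α₂ U σ P)
    (hcont : ∀ (U : X.left.Opens) (σ : Γ(F₂, U)),
      ContinuousOn (fun P ↦ (⟨P, α₂ U σ P⟩ : TotalSpace E₂.F E₂.E)) {P | P.pt ∈ U}) :
    (∀ (U : X.left.Opens) (σ τ : Γ(F₁, U)) (P : ComplexPoints X),
        α₂ U (φ.app U (σ + τ)) P = α₂ U (φ.app U σ) P + α₂ U (φ.app U τ) P) ∧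
    (∀ (U : X.left.Opens) (f : Γ(X.left, U)) (σ : Γ(F₁, U)) (P : ComplexPoints X) (h : P.pt ∈ U),
        α₂ U (φ.app U (f • σ)) P = P.eval U h f • α₂ U (φ.app U σ) P) ∧
    (∀ (U W : X.left.Opens) (hWU : W ≤ U) (σ : Γ(F₁, U)) (P : ComplexPoints X), P.pt ∈ W →
        α₂ W (φ.app W (F₁.presheaf.map (homOfLE hWU).op σ)) P = α₂ U (φ.app U σ) P) ∧
    (∀ (U : X.left.Opens) (σ : Γ(F₁, U)),
        ContinuousOn (fun P ↦ (⟨P, α₂ U (φ.app U σ) P⟩ : TotalSpace E₂.F E₂.E)) {P | P.pt ∈ U}) :=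
  ⟨fun U σ τ P ↦ by rw [map_add, hadd], fun U f σ P h ↦ by rw [Scheme.Modules.Hom.app_smul, hsmul],
    fun U W hWU σ P hP ↦ by rw [app_presheaf_map, hres U W hWU _ P hP], fun U σ ↦ hcont U _⟩

/-- **GAGA functoriality `u ↦ u^an`, topologically**: for data `(E₁, α₁)` of `F₁` (frames of size `r`
near every point) and `(E₂, α₂)` of `F₂` and a morphism `φ : F₁ ⟶ F₂`, there are `ℂ`-linear fibre maps
`u_P : (E₁)_P → (E₂)_P` with `u_P(α₁(σ)(P)) = α₂(φ σ)(P)` for every section `σ` over an open `∋ P.pt`,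
and the total map `E₁ → E₂`, `(P, v) ↦ (P, u_P v)` is continuous.
[cite: SerreGAGA1956, §3 n°9 Déf. 2 and Prop. 10] [cite: MilnorStasheff1974, §2 Thm. 2.2 and Lemma 2.3] -/
theorem exists_bundleMap_of_comparison_hom (φ : F₁ ⟶ F₂)
    (hF : ∀ x : X.left, ∃ (U : X.left.Opens) (s : Fin r → Γ(F₁, U)), x ∈ U ∧ IsSectionFrame F₁ U s)
    (E₁ E₂ : ComplexVectorBundle.{0, 0} (ComplexPoints X))
    (α₁ : ∀ U : X.left.Opens, Γ(F₁, U) → ∀ P : ComplexPoints X, E₁.E P)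
    (α₂ : ∀ U : X.left.Opens, Γ(F₂, U) → ∀ P : ComplexPoints X, E₂.E P)
    (hadd₁ : ∀ (U : X.left.Opens) (σ τ : Γ(F₁, U)) (P : ComplexPoints X), α₁ U (σ + τ) P = α₁ U σ P + α₁ U τ P)
    (hsmul₁ : ∀ (U : X.left.Opens) (f : Γ(X.left, U)) (σ : Γ(F₁, U)) (P : ComplexPoints X) (h : P.pt ∈ U),
      α₁ U (f • σ) P = P.eval U h f • α₁ U σ P)
    (hres₁ : ∀ (U W : X.left.Opens) (hWU : W ≤ U) (σ : Γ(F₁, U)) (P : ComplexPoints X), P.pt ∈ W →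
      α₁ W (F₁.presheaf.map (homOfLE hWU).op σ) P = α₁ U σ P)
    (hcont₁ : ∀ (U : X.left.Opens) (σ : Γ(F₁, U)),
      ContinuousOn (fun P ↦ (⟨P, α₁ U σ P⟩ : TotalSpace E₁.F E₁.E)) {P | P.pt ∈ U})
    (hframe₁ : ∀ (U : X.left.Opens) (t : Fin r → Γ(F₁, U)), IsSectionFrame F₁ U t →
      ∀ P : ComplexPoints X, P.pt ∈ U → LinearIndependent ℂ (fun j ↦ α₁ U (t j) P) ∧
        ⊤ ≤ Submodule.span ℂ (Set.range fun j ↦ α₁ U (t j) P))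
    (hadd₂ : ∀ (U : X.left.Opens) (σ τ : Γ(F₂, U)) (P : ComplexPoints X), α₂ U (σ + τ) P = α₂ U σ P + α₂ U τ P)
    (hsmul₂ : ∀ (U : X.left.Opens) (f : Γ(X.left, U)) (σ : Γ(F₂, U)) (P : ComplexPoints X) (h : P.pt ∈ U),
      α₂ U (f • σ) P = P.eval U h f • α₂ U σ P)
    (hres₂ : ∀ (U W : X.left.Opens) (hWU : W ≤ U) (σ : Γ(F₂, U)) (P : ComplexPoints X), P.pt ∈ W →
      α₂ W (F₂.presheaf.map (homOfLE hWU).op σ) P = α₂ U σ P)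
    (hcont₂ : ∀ (U : X.left.Opens) (σ : Γ(F₂, U)),
      ContinuousOn (fun P ↦ (⟨P, α₂ U σ P⟩ : TotalSpace E₂.F E₂.E)) {P | P.pt ∈ U}) :
    ∃ u : ∀ P : ComplexPoints X, E₁.E P →ₗ[ℂ] E₂.E P,
      (∀ (U : X.left.Opens) (σ : Γ(F₁, U)) (P : ComplexPoints X), P.pt ∈ U →
        u P (α₁ U σ P) = α₂ U (φ.app U σ) P) ∧
      Continuous fun q : TotalSpace E₁.F E₁.E ↦ (⟨q.proj, u q.proj q.2⟩ : TotalSpace E₂.F E₂.E) := by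
  letI : ∀ P : ComplexPoints X, AddCommGroup (E₁.E P) := fun P ↦ Module.addCommMonoidToAddCommGroup ℂ
  letI : ∀ P : ComplexPoints X, AddCommGroup (E₂.E P) := fun P ↦ Module.addCommMonoidToAddCommGroup ℂ
  obtain ⟨hadd', hsmul', hres', hcont'⟩ := comparison_comp_hom φ E₂ α₂ hadd₂ hsmul₂ hres₂ hcont₂
  choose Uof sof hmem hfr using hF
  -- the fibre maps: on the basis `α₁(s_k)(P)` of the frame chosen at `P.pt`, `u(α₁(s_k)(P)) = α₂(φ s_k)(P)`
  let b : ∀ P : ComplexPoints X, Module.Basis (Fin r) ℂ (E₁.E P) := fun P ↦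
    Module.Basis.mk (hframe₁ _ _ (hfr P.pt) P (hmem P.pt)).1 (hframe₁ _ _ (hfr P.pt) P (hmem P.pt)).2
  let u : ∀ P : ComplexPoints X, E₁.E P →ₗ[ℂ] E₂.E P := fun P ↦
    (b P).constr ℂ fun k ↦ α₂ (Uof P.pt) (φ.app _ (sof P.pt k)) P
  have hub : ∀ (P : ComplexPoints X) (k : Fin r), u P (α₁ (Uof P.pt) (sof P.pt k) P) = α₂ (Uof P.pt) (φ.app _ (sof P.pt k)) P := by
    intro P k
    have h := (b P).constr_basis ℂ (fun k ↦ α₂ (Uof P.pt) (φ.app _ (sof P.pt k)) P) k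
    rwa [Module.Basis.mk_apply] at h
  have hu : ∀ (U : X.left.Opens) (σ : Γ(F₁, U)) (P : ComplexPoints X), P.pt ∈ U →
      u P (α₁ U σ P) = α₂ U (φ.app U σ) P := fun U σ P hP ↦
    comparison_eq_of_frame α₁ (fun U σ P ↦ α₂ U (φ.app U σ) P) hadd₁ hsmul₁ hres₁ hadd' hsmul' hres'
      (hfr P.pt) (hmem P.pt) (u P) (hub P) σ hP
  refine ⟨u, hu, ?_⟩
  -- continuity, locally over `U₀(ℂ)` with frame `s₀`: `u(q) = Σ_k c_k(q) α₂(φ s₀ k)(q.proj)`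
  refine continuous_iff_continuousAt.2 fun q₀ ↦ ?_
  obtain ⟨x₀, hx₀⟩ : ∃ x₀ : X.left, q₀.proj.pt = x₀ := ⟨_, rfl⟩
  have hW : IsOpen {q : TotalSpace E₁.F E₁.E | q.proj.pt ∈ Uof x₀} :=
    (AlgPoints.isOpen_setOf_pt_mem (Uof x₀)).preimage (FiberBundle.continuous_proj E₁.F E₁.E)
  have hq₀ : q₀ ∈ {q : TotalSpace E₁.F E₁.E | q.proj.pt ∈ Uof x₀} := by
    change q₀.proj.pt ∈ Uof x₀
    rw [hx₀]
    exact hmem x₀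
  refine ContinuousOn.continuousAt ?_ (hW.mem_nhds hq₀)
  rw [continuousOn_iff_continuous_restrict]
  -- the restricted bundles over `U₀(ℂ)` and their global frames / sections
  let ι₀ : C(complexPointsCompl X (((Uof x₀ : X.left.Opens) : Set X.left)ᶜ), ComplexPoints X) :=
    ⟨Subtype.val, continuous_subtype_val⟩
  have hmem' : ∀ P : complexPointsCompl X (((Uof x₀ : X.left.Opens) : Set X.left)ᶜ), P.1.pt ∈ Uof x₀ :=
    fun P ↦ Set.notMem_compl_iff.1 P.2
  let σ₁ : Fin r → (P : complexPointsCompl X (((Uof x₀ : X.left.Opens) : Set X.left)ᶜ)) → (E₁.pullback ι₀).E P :=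
    fun k P ↦ α₁ (Uof x₀) (sof x₀ k) P.1
  have hσ₁c : ∀ k, Continuous fun P ↦ (⟨P, σ₁ k P⟩ : TotalSpace (E₁.pullback ι₀).F (E₁.pullback ι₀).E) := fun k ↦
    continuous_section_pullback_of_continuous E₁ _ (fun P ↦ α₁ (Uof x₀) (sof x₀ k) P.1)
      ((hcont₁ _ _).comp_continuous continuous_subtype_val hmem')
  have hσ₁b : ∀ P, LinearIndependent ℂ (fun k ↦ σ₁ k P) ∧ ⊤ ≤ Submodule.span ℂ (Set.range fun k ↦ σ₁ k P) :=
    fun P ↦ hframe₁ _ _ (hfr x₀) P.1 (hmem' P)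
  obtain ⟨e, he⟩ := ComplexVectorBundle.exists_iso_trivial_of_frame (E₁.pullback ι₀) σ₁ hσ₁c hσ₁b
  let τ : Fin r → (P : complexPointsCompl X (((Uof x₀ : X.left.Opens) : Set X.left)ᶜ)) → (E₂.pullback ι₀).E P :=
    fun k P ↦ α₂ (Uof x₀) (φ.app _ (sof x₀ k)) P.1
  have hτ : ∀ k, Continuous fun P ↦ (⟨P, τ k P⟩ : TotalSpace (E₂.pullback ι₀).F (E₂.pullback ι₀).E) := fun k ↦
    continuous_section_pullback_of_continuous E₂ _ (fun P ↦ α₂ (Uof x₀) (φ.app _ (sof x₀ k)) P.1)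
      ((hcont' _ _).comp_continuous continuous_subtype_val hmem')
  -- the map into the restricted bundle `E₁|_{U₀(ℂ)}` and the coordinates there
  let j : {q : TotalSpace E₁.F E₁.E | q.proj.pt ∈ Uof x₀} → TotalSpace (E₁.pullback ι₀).F (E₁.pullback ι₀).E :=
    fun q ↦ ⟨⟨q.1.proj, Set.notMem_compl_iff.2 q.2⟩, q.1.2⟩
  have hj : Continuous j :=
    (inducing_pullbackTotalSpaceEmbedding E₁.F E₁.E ι₀).continuous_iff.2
      ((Continuous.subtype_mk ((FiberBundle.continuous_proj E₁.F E₁.E).comp continuous_subtype_val) _).prodMk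
        continuous_subtype_val)
  -- coordinates `c(q) = e⁻¹(j q)` are continuous
  let coord : {q : TotalSpace E₁.F E₁.E | q.proj.pt ∈ Uof x₀} → (Fin r → ℂ) :=
    fun q ↦ ((e.equiv (j q).proj).symm (j q).2 : Fin r → ℂ)
  have hcoord : Continuous coord := by
    have h1 : Continuous fun q ↦ (⟨(j q).proj, (e.equiv (j q).proj).symm (j q).2⟩ :
        TotalSpace (Fin r → ℂ) (Bundle.Trivial (complexPointsCompl X (((Uof x₀ : X.left.Opens) : Set X.left)ᶜ)) (Fin r → ℂ))) :=
      e.continuous_invFun.comp hj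
    exact (continuous_snd.comp (Bundle.Trivial.homeomorphProd _ (Fin r → ℂ)).continuous).comp h1
  -- the composite `q ↦ lift (Σ c_k(q) τ_k)` is continuous and equals the total map of `u`
  have hcomp : Continuous ((Pullback.lift ι₀ : TotalSpace E₂.F (ι₀ *ᵖ E₂.E) → TotalSpace E₂.F E₂.E) ∘
      fun q : {q : TotalSpace E₁.F E₁.E | q.proj.pt ∈ Uof x₀} ↦
        (⟨(j q).proj, ∑ k, coord q k • τ k (j q).proj⟩ : TotalSpace (E₂.pullback ι₀).F (E₂.pullback ι₀).E)) :=
    (Pullback.continuous_lift E₂.F E₂.E ι₀).comp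
      (continuous_totalSpaceMk_sum_smul (E₂.pullback ι₀) τ hτ
        ((Pullback.continuous_proj E₁.F E₁.E ι₀ |>.comp hj)) (fun k q ↦ coord q k)
        (fun k ↦ (continuous_apply k).comp hcoord))
  refine hcomp.congr fun q ↦ ?_
  -- `q = Σ c_k(q) σ₁_k` in the fibre, so `u(q) = Σ c_k(q) u(σ₁_k) = Σ c_k(q) τ_k`
  have hq : q.1.2 = ∑ k, coord q k • α₁ (Uof x₀) (sof x₀ k) q.1.proj := by
    have h := he (j q).proj (coord q)
    rw [ContinuousLinearEquiv.apply_symm_apply] at h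
    exact h
  change (⟨q.1.proj, ∑ k, coord q k • α₂ (Uof x₀) (φ.app _ (sof x₀ k)) q.1.proj⟩ : TotalSpace E₂.F E₂.E) =
    ⟨q.1.proj, u q.1.proj q.1.2⟩
  congr 1
  rw [hq, map_sum]
  refine Finset.sum_congr rfl fun k _ ↦ ?_
  rw [map_smul, hu _ _ _ q.2]

end Summit.HodgeConjecture.HodgeConjecture.Theorems

end
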